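import Literature.IUT.HodgeArakelov.BadPrimeGaussianMonoidsCohomologyModelSectionsProofs

/-!
# [IUTchII] Cor 3.5 (ii) "⥤" from the Kummer map of a module of constants, EXPLICIT-ACTION form (`ρ : Π →* MulAut A`
# instead of a typeclass action; needed to instantiate at records whose group is only DEFINITIONALLY `Π^tp_{X̲̲}`) —
# proof-only twin of `…GaloisKummerActionProofs.lean`

S. Mochizuki, *Inter-universal Teichmüller theory II*, kurims Dec-2020 manuscript, Prop 3.1 (ii) p. 88, Cor 3.5 (i)(ii)
pp. 94–95, Rmk 3.5.2 (iii) p. 98 [cite: Mochizuki2012, Cor 3.5 (ii) p.95]. Claim key DISPUTED (D-0012). PROOF-ONLY companion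
(abc-iut cell, layer L6, seat abc-iut-w4-d004 gen 2; node **IUTchII:Cor3.5(ii)**, Galois clause). NO definition, NO `Prop` fact.
Same content as `BadPrimeGaussianMonoidsGaloisKummerActionProofs.lean` with the `Π`-action on the module of constants `A`
given as an explicit homomorphism `ρ : Π →* MulAut A` (at the genuine record: `MulDistribMulAction.toMulAut Π^tp_{X̲̲} A`),
so that no `MulDistribMulAction` instance has to be found on a group that is only definitionally equal to `Π^tp_{X̲̲}`
(`(modelSystem …).PiX`): `constantMonoid_conj_mem_hom`, `units_conj_mem_hom`, `conj_eq_of_inv_mul_act_hom`,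
`sync_units_of_sections_kummerHom`, `thetaSplit_conjStable_ofKummerHom`, `mrange_pi_diagonalStable'_ofKummerHom_labelwise`.
Nothing here asserts a disputed claim or takes a side on [IUTchIII] Cor 3.12; typed ≠ proved ≠ endorsed.
-/

namespace Literature.IUT.HodgeArakelov

namespace BadPrimeGaussianMonoids

open Literature.AnabelianGeometry.EtaleTheta CohomologySystemOfContH1 TemperedThetaMonoids

universe u v w

section KummerHom

variable {Q : Type u} [Group Q] (E : TemperedThetaMonoids.ThetaEnvData.{u, v} Q)
  {A : Type w} [CommGroup A] (ρ : Q →* MulAut A) (O : Submonoid A)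
  (hO : ∀ (σ : Q) (b : A), b ∈ O → ρ σ b ∈ O) (κ : O →* E.H)

/-- `Ψ_cns = κ(O)` is conjugation-stable (equivariant `κ`). [cite: Mochizuki2012, Prop 3.1 (ii) p.88] -/
theorem constantMonoid_conj_mem_hom (hcns : E.constantMonoid = MonoidHom.mrange κ)
    (hκeq : ∀ (σ : Q) (m : O), κ ⟨ρ σ (m : A), hO σ m m.2⟩ = E.conj σ (κ m)) (σ : Q) {c : E.H}
    (hc : c ∈ E.constantMonoid) : E.conj σ c ∈ E.constantMonoid := by
  rw [hcns] at hc ⊢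
  obtain ⟨m, rfl⟩ := hc
  exact ⟨_, hκeq σ m⟩

/-- `M^×_TM` is conjugation-stable. [cite: Mochizuki2012, Prop 3.1 (ii) p.88] -/
theorem units_conj_mem_hom (hcns : E.constantMonoid = MonoidHom.mrange κ)
    (hκeq : ∀ (σ : Q) (m : O), κ ⟨ρ σ (m : A), hO σ m m.2⟩ = E.conj σ (κ m)) (σ : Q) :
    ∀ u ∈ E.units, E.conj σ u ∈ E.units := by
  intro u hu
  rw [E.units_eq] at hu ⊢
  refine ⟨constantMonoid_conj_mem_hom E ρ O hO κ hcns hκeq σ hu.1, ?_⟩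
  rw [← map_inv]
  exact constantMonoid_conj_mem_hom E ρ O hO κ hcns hκeq σ hu.2

/-- Elements differing by an element acting trivially on `O` act identically on `Ψ_cns` (Rmk 3.5.2 (iii)).
[cite: Mochizuki2012, Rmk 3.5.2 p.98] -/
theorem conj_eq_of_inv_mul_act_hom (hcns : E.constantMonoid = MonoidHom.mrange κ)
    (hκeq : ∀ (σ : Q) (m : O), κ ⟨ρ σ (m : A), hO σ m m.2⟩ = E.conj σ (κ m)) {x x' : Q}
    (hxx' : ∀ a ∈ O, ρ (x⁻¹ * x') a = a) {c : E.H} (hc : c ∈ E.constantMonoid) : E.conj x c = E.conj x' c := by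
  rw [hcns] at hc
  obtain ⟨m, rfl⟩ := hc
  rw [← hκeq, ← hκeq]
  congr 1
  apply Subtype.ext
  change ρ x (m : A) = ρ x' (m : A)
  conv_rhs => rw [show x' = x * (x⁻¹ * x') by group, map_mul, MulAut.mul_apply, hxx' _ m.2]

variable {G : Type*} [Group G] {T : Type*}

/-- Conjugate synchronization of the constants for sections agreeing modulo a subgroup acting trivially on `O`.
[cite: Mochizuki2012, Cor 3.5 (ii) p.94] -/
theorem sync_units_of_sections_kummerHom (hcns : E.constantMonoid = MonoidHom.mrange κ)
    (hκeq : ∀ (σ : Q) (m : O), κ ⟨ρ σ (m : A), hO σ m m.2⟩ = E.conj σ (κ m)) (Δ : Subgroup Q)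
    (hΔ : ∀ δ ∈ Δ, ∀ a ∈ O, ρ δ a = a) (s : T → (G →* Q))
    (hs : ∀ t t' g, (QuotientGroup.mk (s t g) : Q ⧸ Δ) = QuotientGroup.mk (s t' g)) :
    ∀ g t t', ∀ u ∈ E.units, E.conj (s t g) u = E.conj (s t' g) u :=
  fun g t t' _ hu => conj_eq_of_inv_mul_act_hom E ρ O hO κ hcns hκeq
    (fun a ha => hΔ _ (QuotientGroup.eq.mp (hs t t' g)) a ha) (units_le_constantMonoid E hu)

/-- `M^×_TM · θ^ℕ` is stable under the `s_t(g)` (units by the Kummer action, `θ` by `hfix`).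
[cite: Mochizuki2012, Cor 3.5 (ii) p.95] -/
theorem thetaSplit_conjStable_ofKummerHom (hcns : E.constantMonoid = MonoidHom.mrange κ)
    (hκeq : ∀ (σ : Q) (m : O), κ ⟨ρ σ (m : A), hO σ m m.2⟩ = E.conj σ (κ m)) (s : T → (G →* Q)) (θ : E.H)
    (hfix : ∀ g t, E.conj (s t g) θ = θ) (g : G) (t : T) :
    ∀ x ∈ splitMonoid E.units (Submonoid.powers θ), E.conj (s t g) x ∈ splitMonoid E.units (Submonoid.powers θ) :=
  fun x hx => splitMonoid_conjStable E.conj E.units θ (s t g) (units_conj_mem_hom E ρ O hO κ hcns hκeq (s t g))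
    ⟨1, E.units.one_mem, by rw [hfix, one_mul]⟩ x hx

end KummerHom

section Labelwise

variable {Q : Type u} [Group Q] (E : TemperedThetaMonoids.ThetaEnvData.{u, v} Q)
  {A : Type w} [CommGroup A] (ρ : Q →* MulAut A) (O : Submonoid A)
  (hO : ∀ (σ : Q) (b : A), b ∈ O → ρ σ b ∈ O) (κ : O →* E.H)
  {P₀ P : TopGroup.{u}} {G' : Type u} [Group G'] [TopologicalSpace G'] [IsTopologicalGroup G']
  (φ : P →* G') (φ₀ : P₀ →* G') (Am : Subgroup G') [Am.Normal] [IsMulCommutative Am] (N : Subgroup P) [N.Normal]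
  (j : Q →* P) (ψ : Additive E.H ≃+ h1Lim φ Am N ⊥) {L : Type*} (s : L → (P₀ →* Q))
  (hι : ∀ t, Continuous (j.comp (s t))) (hN : ∀ t, (⊤ : Subgroup P₀).map (j.comp (s t)) ≤ N)
  (hφ : ∀ t, φ.comp (j.comp (s t)) = φ₀)

/-- **IUTchII:Cor3.5(ii)** (kurims p.95), the Galois clause at the LABEL-WISE cohomology model from the Kummer map of a
module of constants with EXPLICIT action `ρ` — `hr`, `hfix` discharged, `hs` from "sections of an augmentation whose
kernel acts trivially on `O`". [cite: Mochizuki2012, Cor 3.5 (ii) p.95] -/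
theorem mrange_pi_diagonalStable'_ofKummerHom_labelwise (hcns : E.constantMonoid = MonoidHom.mrange κ)
    (hκeq : ∀ (σ : Q) (m : O), κ ⟨ρ σ (m : A), hO σ m m.2⟩ = E.conj σ (κ m))
    {K : Type*} [Group K] (q : Q →* K) (hq : ∀ x : Q, q x = 1 → ∀ a ∈ O, ρ x a = a) (w : P₀ →* K)
    (hsec : ∀ t g, q (s t g) = w g)
    (hψ : ∀ (p : Q) (y : E.H),
      ψ (Additive.ofMul (E.conj p y)) = h1LimConj φ Am N (j p) (ψ (Additive.ofMul y)))
    (θ : E.H) (hθ : ψ (Additive.ofMul θ) ∈ Set.range ((cohomologySystemOfContH1 φ Am N).toLim ⊤))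
    (R : L → (E.H →* Multiplicative (h1Lim φ₀ Am (⊤ : Subgroup P₀) ⊥)))
    (hR : ∀ t y, Multiplicative.toAdd (R t y) =
      h1LimCongr Am ⊤ (hφ t) ⊥ (h1LimComap φ Am (j.comp (s t)) (hι t) (hN t) (ψ (Additive.ofMul y))))
    (t₀ : L) (g : P₀) :
    (MonoidHom.mrange (MonoidHom.pi fun t =>
        (R t).comp (splitMonoid E.units (Submonoid.powers θ)).subtype)).map
        (piIso L (h1LimConjMulAut φ₀ Am ⊤ g)).toMonoidHom =
      MonoidHom.mrange (MonoidHom.pi fun t => (R t).comp (splitMonoid E.units (Submonoid.powers θ)).subtype) := by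
  have hfix : ∀ g t, E.conj (s t g) θ = θ := conj_section_eq_self_labelwise E φ Am N j ψ s hN hψ hθ
  have hstab := thetaSplit_conjStable_ofKummerHom E ρ O hO κ hcns hκeq s θ hfix
  exact mrange_pi_diagonalStable_submonoid E.conj s (h1LimConjMulAut φ₀ Am ⊤) _ hstab _
    (fun t g' x => restriction_conj_section_eq_labelwise E φ φ₀ Am N j ψ s hι hN hφ hψ R hR t g' (x : E.H))
    (sync_splitMonoid E.conj s E.units θ
      (sync_units_of_sections_kummerHom E ρ O hO κ hcns hκeq q.ker
        (fun δ hδ a ha => hq δ (MonoidHom.mem_ker.mp hδ) a ha) s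
        (sections_mk_eq_of_isSection s q q.ker (fun x hx => MonoidHom.mem_ker.mpr hx) w hsec))
      (fun g t t' => by rw [hfix, hfix])) t₀ g

end Labelwise

end BadPrimeGaussianMonoids

end Literature.IUT.HodgeArakelov
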